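import Mathlib.Data.ZMod.Basic
import Literature.AlgebraicGeometry.Frobenioids.DivisorMonoidCategoryTheoreticityCorSchemaNegative
import Literature.AlgebraicGeometry.Frobenioids.DivisorMonoidCategoryTheoreticityThm42SchemaNegative
import HarnessLib

/-!
# Frobenioids I, Corollary 4.11 (iv), rigidity clause AS TYPED over the data-only interface
# (`PreFrobenioidData.Cor411ivRigid`): the universal closure is false — kernel `¬ ∀` (FACT-LIST row F-1030;
# schema / R5)

Mochizuki, *The geometry of Frobenioids I: the general theory*, Kyushu J. Math. **62** (2008)
293–400, Cor. 4.11 (iv), kurims text p. 92 ("Moreover, each of the composite functors of this diagram is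
rigid"), proof p. 94 [cite: MochizukiFrdI2008, Cor. 4.11 (iv) p.92].

PROOF-ONLY companion (no definitions, no instances) of the statement file
`DivisorMonoidCategoryTheoreticity.lean` (seat abc-iut-L1-t3), cell abc-iut, F fact-proving wave, seat
abc-iut-f-033, FACT-LIST row **F-1030** `PreFrobenioidData.Cor411ivRigid` (class `preparatory`,
kernel_closedness `parametrised`); sequel of seat abc-iut-f-032's `DivisorMonoidCategoryTheoreticityCorSchemaNegative.lean`
(degenerate operations on `B(N_{≥1})`, re-used BY NAME) and of
`DivisorMonoidCategoryTheoreticityCor411ivSchemaNegative.lean` (rows F-1028, F-1029).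

The typed rigidity clause is a schema over the data-only operations `S_i : PreFrobenioidData C_i D_i`
(Def. 1.1 (iv), NOT the Frobenioid axioms of Def. 1.3) and over a BARE functor `Ψ^Base : D₁ → D₂` with a
BARE family of monoid isomorphisms `E` over it. In the degenerate family of f-032 (bases with subsingleton
Hom-sets) every natural automorphism is trivial, so a witness needs a Div-slim base WITH a non-trivial
automorphism: here `D₂ = B(ℤ/2)` carrying `Φ₂ ≡ ℤ_{≥0} × ℤ_{≥0}` on which the involution SWAPS the factors
(a faithful action, so `D₂` is Div-slim although not slim — FrdI Ex. 4.7 (i)), with `Div ≡ 0`, `deg_Fr = id`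
on `C = B(N_{≥1})`:

* `isNonDilating_prodComm` — the swap of `ℤ_{≥0} × ℤ_{≥0}` is non-dilating (Def. 1.1 (i)) vacuously: the
  primary `(1, 0)` is not `≼`-below its image `(0, 1)`;
* `isOfStandardType_of_isNonDilatingOn` — f-032's standard-type lemma with the non-dilating field supplied
  directly (its version assumes identity pull-backs); `isDivSlim_of_pull_faithful` — Div-slimness from a
  faithful action;
* `not_forall_cor411ivRigid` — with `S₁` the degenerate operations (`Φ₁ ≡ ℤ_{≥0} × ℤ_{≥0}`, identity
  pull-backs) over `Discrete PUnit`, `S₂` the swap operations over `B(ℤ/2)`, `Ψ = 𝟭`, `Ψ^Base` the constant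
  functor and `E = id`: `Cor411Setting` holds, the divisor-fixing condition of the second clause is vacuous
  (`Div ≡ 0`), and the constant family `σ` (the involution) is a NON-TRIVIAL automorphism of `Ψ^Base ∘ Base₁`.

Print asserts the clause for THE data of the `1`-commutative diagram of Cor. 4.11 over FROBENIOIDS (every
`x ∈ Φ(Base A)` a divisor, Def. 1.3 (iii)(d)) — an instance PROVED in the tree
(`PreFrobenioid.cor411ivRigid_holds_of_oneCommutes`, `PreFrobenioid.cor411ivRigid_of_baseIso`, seat
abc-iut-f-033; `PreFrobenioid.cor411ivRigid_of_square`, seat abc-iut-L1-d6). So F-1030 is admissible AT NAMED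
INSTANCES ONLY. Bookkeeping about the typing; nothing here bears on [IUTchIII] Cor. 3.12 or takes a side; a
refuted closure is a statement about the schema, not about the paper.
-/

namespace Literature.AlgebraicGeometry.Frobenioids

open CategoryTheory

namespace PreFrobenioidData

namespace CorSchemaNegative

/-! ### The swap of `ℤ_{≥0} × ℤ_{≥0}`; standard type with a prescribed non-dilating field; Div-slimness -/

/-- The identity endomorphism of a divisor monoid is non-dilating (Def. 1.1 (i)).
[cite: MochizukiFrdI2008, Def. 1.1 (i) p.19] -/
theorem isNonDilating_id {M : Type} [CommMonoid M] : IsNonDilating (MonoidHom.id M) := fun _ a => by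
  obtain ⟨m, rfl⟩ := Associates.mk_surjective a
  rw [associatesMap_mk, MonoidHom.id_apply]

/-- **The swap of the factors of `ℤ_{≥0} × ℤ_{≥0}` is non-dilating** (Def. 1.1 (i)) — vacuously: the primary
element `(1, 0)` (seat abc-iut-f-036's `DegreeModel.isPrimary_inl`) is not `≼`-below its image `(0, 1)`, so
the antecedent "`α^char(a) ≼ a` for all primary `a`" fails. [cite: MochizukiFrdI2008, Def. 1.1 (i) p.19] -/
theorem isNonDilating_prodComm :
    IsNonDilating ((MulEquiv.prodComm : DegreeModel.N × DegreeModel.N ≃* DegreeModel.N × DegreeModel.N).toMonoidHom) := by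
  intro h
  exfalso
  have hsharp : IsSharp (DegreeModel.N × DegreeModel.N) := ⟨fun a ha =>
    Prod.ext (DegreeModel.eq_one_of_isUnit_N _ (Prod.isUnit_iff.mp ha).1)
      (DegreeModel.eq_one_of_isUnit_N _ (Prod.isUnit_iff.mp ha).2)⟩
  have hinj : Function.Injective (Associates.mk : DegreeModel.N × DegreeModel.N → Associates _) := by
    intro a b hab
    obtain ⟨u, hu⟩ := Associates.mk_eq_mk_iff_associated.mp hab
    rw [hsharp.eq_one_of_isUnit _ u.isUnit, mul_one] at hu
    exact hu
  let e : DegreeModel.N × DegreeModel.N ≃* Associates (DegreeModel.N × DegreeModel.N) :=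
    MulEquiv.ofBijective (Associates.mkMonoidHom (M := DegreeModel.N × DegreeModel.N)) ⟨hinj, Associates.mk_surjective⟩
  have hprim : IsPrimary (Associates.mk ((Multiplicative.ofAdd 1, 1) : DegreeModel.N × DegreeModel.N)) :=
    (isPrimary_map_iff e).mpr DegreeModel.isPrimary_inl
  obtain ⟨n, -, c, hc⟩ := h _ hprim
  rw [associatesMap_mk, ← Associates.mk_pow] at hc
  obtain ⟨c, rfl⟩ := Associates.mk_surjective c
  rw [Associates.mk_mul_mk, Associates.mk_eq_mk_iff_associated] at hc
  obtain ⟨u, hu⟩ := hc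
  rw [hsharp.eq_one_of_isUnit _ u.isUnit, mul_one] at hu
  -- second coordinates: `1 ^ n = 1 · c.2` is impossible in `ℤ_{≥0}`
  have h2 := congrArg (fun p : DegreeModel.N × DegreeModel.N => Multiplicative.toAdd p.2) hu
  simp only [Prod.pow_snd, one_pow, Prod.snd_mul, MulEquiv.coe_toMonoidHom, MulEquiv.coe_prodComm,
    Prod.snd_swap, toAdd_one, toAdd_mul, toAdd_ofAdd] at h2
  omega

/-- Seat abc-iut-f-032's standard-type lemma for the degenerate operations on `B(N_{≥1})` (`deg_Fr = id`,
`Div = 0`, base arrows invertible, `Φ` non-trivial) with the non-dilating field SUPPLIED (their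
`isOfStandardType` assumes identity pull-backs). [cite: MochizukiFrdI2008, Def. 3.1 (i) p.56] -/
theorem isOfStandardType_of_isNonDilatingOn {D : Type} [Category.{0} D]
    (S : PreFrobenioidData.{0} (SingleObj ℕ+) D)
    (hdeg : ∀ {x y : SingleObj ℕ+} (φ : x ⟶ y), S.degFr φ = φ)
    (hdiv : ∀ {x y : SingleObj ℕ+} (φ : x ⟶ y), S.div φ = 1)
    (hiso : ∀ {X Y : D} (f : X ⟶ Y), IsIso f)
    (hM : ∀ A : SingleObj ℕ+, ∃ m : S.Mon (S.base.obj A), m ≠ 1) (hnd : S.IsNonDilatingOn) :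
    S.IsOfStandardType where
  quasiIsotropic := ⟨fun A => ⟨fun h => (h (isIsotropic S hdeg A)).elim,
    fun h => (not_isIsoSubanchor A h).elim⟩⟩
  frobeniusIsotropic := ⟨fun A => ⟨A, 𝟙 A, isFrobeniusType S hdeg hdiv hiso _, isIsotropic S hdeg A⟩⟩
  frobeniusCompact_of_groupLike := fun hG => (not_isOfGroupLikeType S hM hG).elim
  frobeniusNormalized := ⟨fun A φ _ α hα => by
    have hα1 : (show ℕ+ from α) = 1 := (isLinear_iff S hdeg α).mp hα.2
    have hα2 : α = 1 := hα1
    rw [hα2, one_pow, one_mul, mul_one]⟩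
  fsmff := (⟨fun f _ => hiso f⟩ : IsOfFSMType D).isOfFSMFFType
  nonDilating := hnd

/-- Div-slimness (Def. 4.5 (iv)) from a FAITHFUL action of endomorphisms on the divisor monoids: if only
identities pull back to the identity, an automorphism of `D_A → D` acting trivially on `Φ` has identity
components. [cite: MochizukiFrdI2008, Def. 4.5 (iv) p.86] -/
theorem isDivSlim_of_pull_faithful {C D : Type} [Category.{0} C] [Category.{0} D]
    (T : PreFrobenioidData.{0} C D)
    (hf : ∀ {X : D} (g : X ⟶ X), (∀ x : T.Mon X, T.pull g x = x) → g = 𝟙 X) : T.IsDivSlim :=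
  ⟨fun _ α hα => by
    ext B
    exact hf _ (hα B)⟩

end CorSchemaNegative

open CorSchemaNegative

/-! ### F-1030: the universal closure of `Cor411ivRigid` is false -/

/-- **F-1030 (FACT-LIST), schema negative.** The universal closure of the typed rigidity clause of
Cor. 4.11 (iv) `PreFrobenioidData.Cor411ivRigid` — quantified over the data-only operations and over a
BARE `Ψ^Base` with a BARE `Ψ^Φ`-candidate `E` — is false. Witness: `C₁ = C₂ = B(N_{≥1})` with
`deg_Fr = id`, `Div ≡ 0`, `Φ ≡ ℤ_{≥0} × ℤ_{≥0}`; `D₁ = Discrete PUnit` (identity pull-backs), `D₂ = B(ℤ/2)`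
whose involution `σ` SWAPS the two factors (faithful, so `D₂` is Div-slim; the swap is non-dilating); `Ψ = 𝟭`,
`Ψ^Base` the constant functor, `E = id`. Then `Cor411Setting` holds, the divisor-fixing hypothesis of the
second clause is vacuous (`Div ≡ 0`), but the constant family `σ` is a non-trivial automorphism of
`Ψ^Base ∘ Base₁`. Print asserts the clause for THE data over FROBENIOIDS (where every element of `Φ(Base A)`
is a divisor, Def. 1.3 (iii)(d)), an instance PROVED in the tree (`PreFrobenioid.cor411ivRigid_holds_of_oneCommutes`,
`PreFrobenioid.cor411ivRigid_of_baseIso`, seat abc-iut-f-033; `PreFrobenioid.cor411ivRigid_of_square`, seat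
abc-iut-L1-d6). [cite: MochizukiFrdI2008, Cor. 4.11 (iv) p.92] -/
theorem not_forall_cor411ivRigid :
    ¬ ∀ (C₁ : Type) [Category.{0} C₁] (D₁ : Type) [Category.{0} D₁]
        (C₂ : Type) [Category.{0} C₂] (D₂ : Type) [Category.{0} D₂]
        (S₁ : PreFrobenioidData.{0} C₁ D₁) (S₂ : PreFrobenioidData.{0} C₂ D₂) (Ψ : C₁ ≌ C₂)
        (ΨBase : D₁ ⥤ D₂) (E : DivisorMonoidIsoOverBase S₁ S₂ ΨBase),
        S₁.Cor411ivRigid S₂ Ψ ΨBase E := by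
  intro h
  -- the two bases and the involution `σ` of `B(ℤ/2)`
  have hZ : ∀ z : ZMod 2, z = 0 ∨ z = 1 := by decide
  let G : Type := Multiplicative (ZMod 2)
  let σ : G := Multiplicative.ofAdd 1
  have hG : ∀ g : G, g = 1 ∨ g = σ := fun g => by
    rcases hZ (Multiplicative.toAdd g) with h0 | h1
    · exact Or.inl (congrArg Multiplicative.ofAdd h0)
    · exact Or.inr (congrArg Multiplicative.ofAdd h1)
  have hσ1 : σ ≠ 1 := fun h => absurd (congrArg Multiplicative.toAdd h) (show ¬ ((1 : ZMod 2) = 0) by decide)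
  have hσσ : σ * σ = 1 := congrArg Multiplicative.ofAdd (show (1 + 1 : ZMod 2) = 0 by decide)
  let M : Type := DegreeModel.N × DegreeModel.N
  let inl : M := (Multiplicative.ofAdd 1, 1)
  have hinl : inl ≠ 1 := DegreeModel.isPrimary_inl.1
  let swapHom : M →* M := (MulEquiv.prodComm : M ≃* M).toMonoidHom
  have hswap_inl : swapHom inl ≠ inl := fun h =>
    Nat.zero_ne_one (congrArg (fun p : M => Multiplicative.toAdd p.1) h)
  have hswap_swap : ∀ x : M, swapHom (swapHom x) = x := fun x => Prod.swap_swap x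
  classical
  -- `S₁`: degenerate operations over `Discrete PUnit`, `Φ₁ ≡ ℤ_{≥0} × ℤ_{≥0}`, identity pull-backs
  let S₁ : PreFrobenioidData.{0} (SingleObj ℕ+) (Discrete PUnit.{1}) :=
    { base := (Functor.const _).obj ⟨⟨⟩⟩
      Mon := fun _ => M
      pull := fun _ => MonoidHom.id _
      pull_id := fun _ _ => rfl
      pull_comp := fun _ _ _ => rfl
      div := fun _ => 1
      degFr := fun φ => φ
      div_id := fun _ => rfl
      div_comp := fun _ _ => by simp
      degFr_id := fun _ => rfl
      degFr_comp := fun ψ φ => mul_comm (show ℕ+ from φ) (show ℕ+ from ψ) }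
  -- `S₂`: the swap operations over `B(ℤ/2)`
  let act : G → (M →* M) := fun g => if g = 1 then MonoidHom.id M else swapHom
  have act_one : act 1 = MonoidHom.id M := if_pos rfl
  have act_σ : act σ = swapHom := if_neg hσ1
  have act_mul : ∀ (a b : G) (x : M), act (a * b) x = act b (act a x) := by
    intro a b x
    rcases hG a with rfl | rfl <;> rcases hG b with rfl | rfl
    · rw [mul_one, act_one]; rfl
    · rw [one_mul, act_one]; rfl
    · rw [mul_one, act_one]; rfl
    · rw [hσσ, act_one, act_σ, MonoidHom.id_apply, hswap_swap]
  let S₂ : PreFrobenioidData.{0} (SingleObj ℕ+) (SingleObj G) :=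
    { base := (Functor.const _).obj (SingleObj.star G)
      Mon := fun _ => M
      pull := fun g => act g
      pull_id := fun X x => by
        show act (𝟙 X) x = x
        rw [SingleObj.id_as_one, act_one, MonoidHom.id_apply]
      pull_comp := fun β α x => by
        show act (β ≫ α) x = act β (act α x)
        rw [SingleObj.comp_as_mul, act_mul]
      div := fun _ => 1
      degFr := fun φ => φ
      div_id := fun _ => rfl
      div_comp := fun _ _ => by simp
      degFr_id := fun _ => rfl
      degFr_comp := fun ψ φ => mul_comm (show ℕ+ from φ) (show ℕ+ from ψ) }
  have hM₁ : ∀ A : SingleObj ℕ+, ∃ m : S₁.Mon (S₁.base.obj A), m ≠ 1 := fun _ => ⟨inl, hinl⟩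
  have hM₂ : ∀ A : SingleObj ℕ+, ∃ m : S₂.Mon (S₂.base.obj A), m ≠ 1 := fun _ => ⟨inl, hinl⟩
  -- `S₂` is non-dilating and Div-slim (the action is faithful); both are of standard type
  have hnd₂ : S₂.IsNonDilatingOn := ⟨fun X f => by
    show IsNonDilating (act f)
    rcases hG f with hf | hf
    · rw [hf, act_one]; exact isNonDilating_id
    · rw [hf, act_σ]; exact isNonDilating_prodComm⟩
  have hds₂ : S₂.IsDivSlim := isDivSlim_of_pull_faithful S₂ fun {X} g hg => by
    rcases hG g with hg1 | hgσ
    · rw [SingleObj.id_as_one]; exact hg1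
    · have h1 := hg inl
      change act g inl = inl at h1
      rw [hgσ, act_σ] at h1
      exact absurd h1 hswap_inl
  have hst₁ : S₁.IsOfStandardType :=
    isOfStandardType S₁ (fun _ => rfl) (fun _ => rfl) (fun f => inferInstance) hM₁ (fun _ _ _ => rfl)
  have hst₂ : S₂.IsOfStandardType :=
    isOfStandardType_of_isNonDilatingOn S₂ (fun _ => rfl) (fun _ => rfl) (fun f => inferInstance) hM₂ hnd₂
  have hs : S₁.Cor411Setting S₂ CategoryTheory.Equivalence.refl :=
    { divSlim := ⟨isDivSlim_of_subsingleton S₁ fun X Y => inferInstance, hds₂⟩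
      standard := ⟨hst₁, hst₂⟩
      hypB := fun hg _ => (not_isOfGroupLikeType S₁ hM₁ hg).elim }
  -- the junk `Ψ^Base` (constant) and `Ψ^Φ`-candidate (identity)
  let ΨBase : Discrete PUnit.{1} ⥤ SingleObj G := (Functor.const _).obj (SingleObj.star G)
  let E : DivisorMonoidIsoOverBase S₁ S₂ ΨBase :=
    { iso := fun _ => MulEquiv.refl M
      natural := fun _ _ f x => by
        show (x : M) = act (𝟙 (SingleObj.star G)) x
        rw [SingleObj.id_as_one, act_one, MonoidHom.id_apply] }
  obtain ⟨-, h2⟩ := h _ _ _ _ S₁ S₂ CategoryTheory.Equivalence.refl ΨBase E hs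
  -- the constant family `σ`: a non-trivial automorphism of `Ψ^Base ∘ Base₁` fixing all (zero) divisors
  let σiso : SingleObj.star G ≅ SingleObj.star G :=
    { hom := σ
      inv := σ
      hom_inv_id := by rw [SingleObj.comp_as_mul, SingleObj.id_as_one]; exact hσσ
      inv_hom_id := by rw [SingleObj.comp_as_mul, SingleObj.id_as_one]; exact hσσ }
  let α : S₁.base ⋙ ΨBase ≅ S₁.base ⋙ ΨBase :=
    NatIso.ofComponents (fun _ => σiso) fun φ => by
      show 𝟙 (SingleObj.star G) ≫ σiso.hom = σiso.hom ≫ 𝟙 _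
      rw [Category.id_comp, Category.comp_id]
  have hfix : ∀ ⦃A B : SingleObj ℕ+⦄ (φ : A ⟶ B),
      S₂.pull (α.hom.app A) (E.iso (S₁.base.obj A) (S₁.div φ)) = E.iso (S₁.base.obj A) (S₁.div φ) := by
    intro A B φ
    show S₂.pull (α.hom.app A) (MulEquiv.refl M 1) = MulEquiv.refl M 1
    rw [MulEquiv.refl_apply, map_one]
  have hα := congrArg (fun β : S₁.base ⋙ ΨBase ≅ S₁.base ⋙ ΨBase => β.hom.app (SingleObj.star ℕ+)) (h2 α hfix)
  have hσ : σiso.hom = 𝟙 (SingleObj.star G) := hα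
  exact hσ1 (hσ.trans (SingleObj.id_as_one G (SingleObj.star G)))

end PreFrobenioidData

end Literature.AlgebraicGeometry.Frobenioids
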